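import Summits.CriticalPhenomena.PercolationContinuityZ3.Theses.PercNearOneGluing
import Summits.CriticalPhenomena.PercolationContinuityZ3.Theorems.PercNearOneGluingAdditiveGluingSuffices
import Summits.CriticalPhenomena.PercolationContinuityZ3.Theorems.PercNearOneGluingNoHeavyLowerTailResidualOfNearOneGluing
import Summits.CriticalPhenomena.PercolationContinuityZ3.Theorems.PercNearOneGluingNoHeavyLowerTailReduction
import Literature.Probability.Percolation.PercolationEvents
import Literature.Probability.LatticeModels.ProdBernoulliIndependence
import HarnessLib

/-!
# Crux `PercNearOneGluing.NoHeavyLowerTail` (stmt-CriticalPhenomena-4575) — line `additive-shortening`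

Lead c7 (prover-line-stmt-CriticalPhenomena-4575-c7-0), 2026-08-17.  Skeleton of the line registered by
strategist rtask-18c69063 (`birth.lean`, stubs `stub_additiveShorteningStep`, `stub_additiveLemma13`),
reconstructed from the registered signatures (the strategist's file is not mounted in this jail).

Idea (the ADDITIVE analogue of Kozma–Nitzan's §5.3 programme, arXiv:2401.12397 p.34):

* `stub_additiveShorteningStep` — the additive shortening step (weaker than KN Conjecture 6): for a weight
  function `w` with `w s(v,x) = 0`, `v ∉ A`, `v ≠ x`, `a₀ ∈ A` a minimiser of `P_w(· ↔ b)` on `A`, and the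
  additive Conjecture 1 known for every weight function supported inside the support of `w` (induction
  hypothesis, displayed), in the glued graph `w[s(v,x) ↦ 1]` one has
  `P(v ↔ A) − P(a₀ ↮ b) ≤ P(v ↔ b)` — additive Conjecture 1 at the glued source AGAINST THE OLD MINIMISER.
* `stub_additiveLemma13` — the additive Lemma 13: the step implies additive Conjecture 1
  (`P(o ↔ A) − (1 − t) ≤ P(o ↔ b)` whenever `t ≤ P(a ↔ b)` on `A ≠ ∅`) by strong induction on the number of
  positive pairs; every probability is AFFINE in one weight, `X − Y + 1 − Z = (1−p)(X₀ − Y₀ + 1 − Z₀) +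
  p (X₁ − Y₁ + 1 − Z₁)` with the SAME relay `a₀` (the `H₀`-minimiser) in both terms — no cross term.
* glue (real, below): additive Conjecture 1 ⇒ `AdditiveGluing` (item 4576's statement) ⇒ `NearOneGluing`
  (`additiveGluingSuffices_proof`, δ = ε/2) ⇒ the many-fingers residual
  (`manyFingersLargePocket_of_nearOneGluing`) ⇒ `NoHeavyLowerTail` (`noHeavyLowerTail_of_manyFingersLargePocket`).

`NoHeavyLowerTail_of` concludes the crux BY NAME (closed term over the two stubs); sorries only in `stub_*`.
-/

namespace Summit.CriticalPhenomena.PercolationContinuityZ3.Cruxes.NoHeavyLowerTail.AdditiveShortening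

open MeasureTheory Set Literature.Probability.LatticeModels Literature.Probability.Percolation
open Summit.CriticalPhenomena.PercolationContinuityZ3.Theses.PercNearOneGluing
open Summit.CriticalPhenomena.PercolationContinuityZ3.Theorems
open scoped Classical BigOperators

/-- The additive shortening step (registered stub; the conjectural kernel of the line). -/
theorem stub_additiveShorteningStep : ∀ (n : ℕ) (w : Sym2 (Fin n) → unitInterval) (A : Finset (Fin n)) (b v x a₀ : Fin n), v ∉ A → v ≠ x → w s(v, x) = 0 → a₀ ∈ A → (∀ a ∈ A, (prodBernoulli w).real (openConn a₀ b) ≤ (prodBernoulli w).real (openConn a b)) → (∀ w' : Sym2 (Fin n) → unitInterval, (∀ e, w e = 0 → w' e = 0) → ∀ (A' : Finset (Fin n)) (o' b' : Fin n) (t : ℝ), A'.Nonempty → (∀ a ∈ A', t ≤ (prodBernoulli w').real (openConn a b')) → (prodBernoulli w').real (⋃ a ∈ A', openConn o' a) - (1 - t) ≤ (prodBernoulli w').real (openConn o' b')) → (prodBernoulli (Function.update w s(v, x) 1)).real (⋃ a ∈ A, openConn v a) - (1 - (prodBernoulli (Function.update w s(v, x) 1)).real (openConn a₀ b)) ≤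 (prodBernoulli (Function.update w s(v, x) 1)).real (openConn v b) := by
  sorry

/-- The additive Lemma 13 (registered stub; provable: affine one-bond induction). -/
theorem stub_additiveLemma13 : (∀ (n : ℕ) (w : Sym2 (Fin n) → unitInterval) (A : Finset (Fin n)) (b v x a₀ : Fin n), v ∉ A → v ≠ x → w s(v, x) = 0 → a₀ ∈ A → (∀ a ∈ A, (prodBernoulli w).real (openConn a₀ b) ≤ (prodBernoulli w).real (openConn a b)) → (∀ w' : Sym2 (Fin n) → unitInterval, (∀ e, w e = 0 → w' e = 0) → ∀ (A' : Finset (Fin n)) (o' b' : Fin n) (t : ℝ), A'.Nonempty → (∀ a ∈ A', t ≤ (prodBernoulli w').real (openConn a b')) → (prodBernoulli w').real (⋃ a ∈ A', openConn o' a) - (1 - t) ≤ (prodBernoulli w').real (openConn o' b')) → (prodBernoulli (Function.update w s(v, x) 1)).real (⋃ a ∈ A, openConn v a) - (1 - (prodBernoulli (Function.update w s(v, x) 1)).real (openConn a₀ b)) ≤ (prodBernoulli (Function.update w s(v, x) 1)).real (openConn v b)) → ∀ (n : ℕ) (w : Sym2 (Fin n) → unitInterval) (A : Finset (Fin n)) (o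 b : Fin n) (t : ℝ), A.Nonempty → (∀ a ∈ A, t ≤ (prodBernoulli w).real (openConn a b)) → (prodBernoulli w).real (⋃ a ∈ A, openConn o a) - (1 - t) ≤ (prodBernoulli w).real (openConn o b) := by
  sorry

/-- Additive Conjecture 1 (min-free typing), from the two stubs. -/
theorem addConj1 : ∀ (n : ℕ) (w : Sym2 (Fin n) → unitInterval) (A : Finset (Fin n)) (o b : Fin n) (t : ℝ), A.Nonempty → (∀ a ∈ A, t ≤ (prodBernoulli w).real (openConn a b)) → (prodBernoulli w).real (⋃ a ∈ A, openConn o a) - (1 - t) ≤ (prodBernoulli w).real (openConn o b) :=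
  stub_additiveLemma13 stub_additiveShorteningStep

/-- Additive Conjecture 1 ⇒ the route statement `AdditiveGluing` (item 4576's form, slack
`t ≥ max_a P(a ↮ b)`): for `A = ∅` the left side is `−t ≤ 0 ≤ P(o ↔ b)`; otherwise apply `addConj1`
with `1 − t`. -/
theorem additiveGluing_of_stubs : AdditiveGluing := by
  intro n w A o b t ht hA
  rcases A.eq_empty_or_nonempty with hAe | hAne
  · subst hAe
    simp only [Finset.notMem_empty, Set.iUnion_of_empty, Set.iUnion_empty, measureReal_empty]
    linarith [measureReal_nonneg (μ := prodBernoulli w) (s := openConn o b)]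
  · have key := addConj1 n w A o b (1 - t) hAne (fun a ha => hA a ha)
    linarith

/-- **Composition**: the two stubs give the crux `NoHeavyLowerTail` by name
(step ⇒ additive Conjecture 1 ⇒ AdditiveGluing ⇒ NearOneGluing (δ = ε/2) ⇒ residual ⇒ crux). -/
theorem NoHeavyLowerTail_of : NoHeavyLowerTail :=
  noHeavyLowerTail_of_manyFingersLargePocket
    (manyFingersLargePocket_of_nearOneGluing (additiveGluingSuffices_proof additiveGluing_of_stubs))

end Summit.CriticalPhenomena.PercolationContinuityZ3.Cruxes.NoHeavyLowerTail.AdditiveShortening
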